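import Literature.Analysis.FluidPDE.NavierStokesReynoldsLimit
import HarnessLib

/-!
# The limit of a Cheskidov–Luo sequence is a weak Navier–Stokes solution

Continuation of `Literature.Analysis.FluidPDE.NavierStokesReynoldsLimit` (Cheskidov–Luo 2022,
§2.6, proof of Thm. 1.7, for an abstract `Torus.CheskidovLuoSequence`). Here the weak formulation
is passed to the limit [cite: CheskidovLuo2022, §2.6 (proof of Thm. 1.7)]:

> "take any `φ ∈ 𝒟_T`, then using weak formulation of (2.1) or integrating by parts we have
> `∫ uₙ(0)·φ(0) = -∫∫ (uₙ·Δφ + uₙ ⊗ uₙ : ∇φ + uₙ·∂ₜφ) - ∫∫ Rₙ : ∇φ`. Since `uₙ → u` in `L²_{t,x}`,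
> `Rₙ → 0` in `L¹_{t,x}`, and `uₙ(0, x) ≡ v(0, x)` for all `n ≥ 1`, it follows that all terms
> above converge to their natural limits and hence `u` is a weak solution of (1.1)."

Formally (`CheskidovLuoSequence.isWeakNSSolutionWithDataOn_lim`): the limit `D.lim` is a weak
solution on `𝕋^d × [0, T)` with datum `u₀(0)` in the sense of the accepted
`Torus.IsWeakNSSolutionWithDataOn T 1 (u₀ 0)`. The identity for each `uₖ` is the proved
`Torus.IsNSReynoldsOn.weak_identity`; its Reynolds defect tends to zero by
`Torus.norm_integral_reynoldsDefect_le_eLqLpNorm` (`‖Rₖ‖_{L¹L¹} → 0`); and the space–time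
functional of `uₖ` converges to that of the limit by dominated convergence in time: at a.e. `t`
the slice `uₖ(t)` IS `u(t)` for `k` large (stabilisation off the null residual set), and the
slice functionals are dominated by `c₁ + c₂ ‖uₖ(t)‖²_{L²} ≤ c₁ + c₂ H(t)²` with the
square-integrable majorant `H` of the previous file (this replaces the `L²_{t,x}` convergence of
the printed argument by the equivalent domination it provides). Measurability, square
integrability and the divergence condition of the limit are
`aestronglyMeasurable_stLift_lim`, `lintegral_lintegral_enorm_lim_sq_lt_top`,
`ae_isWeaklyDivFree_lim` there.

## References

* A. Cheskidov, X. Luo, Invent. Math. 229 (2022) 987–1054; arXiv:2009.06596, §2.6. [`CheskidovLuo2022`]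
-/

open MeasureTheory Set Filter
open scoped ENNReal NNReal InnerProductSpace _root_.Topology

noncomputable section

namespace Literature.Analysis.FluidPDE

namespace Torus

variable {d : Type*} [Fintype d] [DecidableEq d]

/-! ## Pointwise and slice-wise domination of the weak Navier–Stokes integrand -/

omit [DecidableEq d] in
/-- Pointwise bound of the weak Navier–Stokes integrand
`⟪a, P⟫ + ⟪a, ∑ᵢ aᵢ Dᵢ⟫ + 1·⟪a, L⟫` (with `P = ∂ₜψ`, `Dᵢ = ∂ᵢψ`, `L = Δψ` at a point) by
`(K₁ + K₃) + (K₁ + K₃ + card d · K₂) ‖a‖²` when `‖P‖ ≤ K₁`, `‖Dᵢ‖ ≤ K₂`, `‖L‖ ≤ K₃` (from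
`Torus.abs_weakIntegrand_sub_le` with `b = 0` and `‖a‖ ≤ 1 + ‖a‖²`). [folklore] -/
theorem abs_weakIntegrand_le (a P L : EuclideanSpace ℝ d) (D : d → EuclideanSpace ℝ d)
    {K₁ K₂ K₃ : ℝ} (hK₁ : 0 ≤ K₁) (hK₃ : 0 ≤ K₃) (hP : ‖P‖ ≤ K₁)
    (hD : ∀ i, ‖D i‖ ≤ K₂) (hL : ‖L‖ ≤ K₃) :
    |⟪a, P⟫_ℝ + ⟪a, ∑ i, a i • D i⟫_ℝ + 1 * ⟪a, L⟫_ℝ| ≤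
      (K₁ + K₃) + (K₁ + K₃ + Fintype.card d * K₂) * ‖a‖ ^ 2 := by
  have h1 := abs_weakIntegrand_sub_le a 0 P D hP hD
  simp only [inner_zero_left, PiLp.zero_apply, zero_smul, Finset.sum_const_zero, add_zero,
    sub_zero, norm_zero] at h1
  have h2 : |1 * ⟪a, L⟫_ℝ| ≤ ‖a‖ * K₃ := by
    rw [one_mul]
    exact (abs_real_inner_le_norm _ _).trans (mul_le_mul_of_nonneg_left hL (norm_nonneg _))
  have hn : 0 ≤ ‖a‖ := norm_nonneg _
  have hn1 : ‖a‖ ≤ 1 + ‖a‖ ^ 2 := by nlinarith [sq_nonneg (‖a‖ - 1)]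
  calc |⟪a, P⟫_ℝ + ⟪a, ∑ i, a i • D i⟫_ℝ + 1 * ⟪a, L⟫_ℝ|
      ≤ |⟪a, P⟫_ℝ + ⟪a, ∑ i, a i • D i⟫_ℝ| + |1 * ⟪a, L⟫_ℝ| := abs_add_le _ _
    _ ≤ ‖a‖ * (K₁ + Fintype.card d * K₂ * ‖a‖) + ‖a‖ * K₃ := add_le_add h1 h2
    _ = ‖a‖ * (K₁ + K₃) + Fintype.card d * K₂ * ‖a‖ ^ 2 := by ring
    _ ≤ (1 + ‖a‖ ^ 2) * (K₁ + K₃) + Fintype.card d * K₂ * ‖a‖ ^ 2 := by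
        gcongr
    _ = (K₁ + K₃) + (K₁ + K₃ + Fintype.card d * K₂) * ‖a‖ ^ 2 := by ring

/-- **Slice-wise domination of the weak Navier–Stokes functional**: for a smooth slice `a`, a
field `P` and a smooth test slice `φ` with `‖P‖ ≤ K₁`, `‖∂ᵢφ‖ ≤ K₂`, `‖Δφ‖ ≤ K₃` on `𝕋^d`,
`|∫ (⟪a, P⟫ + ⟪a, (a·∇)φ⟫ + 1·⟪a, Δφ⟫)| ≤ (K₁ + K₃) + (K₁ + K₃ + card d · K₂) ‖a‖²_{L²}`. [folklore] -/
theorem abs_integral_weakIntegrand_le {a P : UnitAddTorus d → EuclideanSpace ℝ d}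
    {φ : UnitAddTorus d → EuclideanSpace ℝ d} (ha : FunctionSpaces.Torus.IsSmooth a)
    (hφ : FunctionSpaces.Torus.IsSmooth φ) {K₁ K₂ K₃ : ℝ} (hK₁ : 0 ≤ K₁)
    (hK₃ : 0 ≤ K₃) (hPb : ∀ x, ‖P x‖ ≤ K₁)
    (hDb : ∀ x, ∀ i, ‖FunctionSpaces.Torus.partialDeriv i φ x‖ ≤ K₂)
    (hLb : ∀ x, ‖FunctionSpaces.Torus.laplacian φ x‖ ≤ K₃) :
    |∫ x, (⟪a x, P x⟫_ℝ + ⟪a x, FunctionSpaces.Torus.convect a φ x⟫_ℝ +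
        1 * ⟪a x, FunctionSpaces.Torus.laplacian φ x⟫_ℝ)| ≤
      (K₁ + K₃) + (K₁ + K₃ + Fintype.card d * K₂) * (eLpNorm a 2 volume ^ 2).toReal := by
  set c₁ : ℝ := K₁ + K₃ with hc₁
  set c₂ : ℝ := K₁ + K₃ + Fintype.card d * K₂ with hc₂
  have hconv : ∀ x, FunctionSpaces.Torus.convect a φ x =
      ∑ i, a x i • FunctionSpaces.Torus.partialDeriv i φ x := fun x =>
    FunctionSpaces.Torus.fderiv_apply_eq_sum_partialDeriv (hφ.isContDiff (by simp)) x (a x)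
  have hpt : ∀ x, ‖⟪a x, P x⟫_ℝ + ⟪a x, FunctionSpaces.Torus.convect a φ x⟫_ℝ +
      1 * ⟪a x, FunctionSpaces.Torus.laplacian φ x⟫_ℝ‖ ≤ c₁ + c₂ * ‖a x‖ ^ 2 := by
    intro x
    rw [Real.norm_eq_abs, hconv x]
    exact abs_weakIntegrand_le (a x) (P x) _ _ hK₁ hK₃ (hPb x) (hDb x) (hLb x)
  have hsq : Continuous fun x => ‖a x‖ ^ 2 := ha.continuous.norm.pow 2
  have hg : Integrable (fun x => c₁ + c₂ * ‖a x‖ ^ 2) volume :=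
    (continuous_const.add (continuous_const.mul hsq)).integrable_unitAddTorus
  rw [← Real.norm_eq_abs]
  refine (norm_integral_le_of_norm_le hg (ae_of_all _ hpt)).trans (le_of_eq ?_)
  have hsqi : Integrable (fun x => c₂ * ‖a x‖ ^ 2) volume := hsq.integrable_unitAddTorus.const_mul c₂
  rw [integral_add (integrable_const c₁) hsqi, integral_const_mul,
    CheskidovLuoSequence.integral_norm_sq_eq_toReal ha.continuous]
  simp

namespace CheskidovLuoSequence

variable {T ε p : ℝ} (D : CheskidovLuoSequence d T ε p)

/-! ## The weak formulation in the limit -/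

/-- **The limit of a Cheskidov–Luo sequence is a weak solution of the unforced Navier–Stokes
equations (viscosity `1`) on `𝕋^d × [0, T)` with datum `u₀(0)`**, in the sense of the accepted
`Torus.IsWeakNSSolutionWithDataOn` (Cheskidov–Luo 2022, §2.6: "all terms above converge to their
natural limits and hence `u` is a weak solution of (1.1)"). Measurability, square integrability
and a.e. weak divergence-freeness are in `NavierStokesReynoldsLimit`; the identity is the limit of
the identities `Torus.IsNSReynoldsOn.weak_identity` of the `uₖ` (datum `uₖ(0) = u₀(0)`), whose
Reynolds defects tend to `0` in terms of `‖Rₖ‖_{L¹(0,T;L¹)}` and whose bulk terms converge by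
dominated convergence in time (a.e. stabilisation of the slices, domination by
`c₁ + c₂ H(t)²`). [cite: CheskidovLuo2022, §2.6 (proof of Thm. 1.7)] -/
theorem isWeakNSSolutionWithDataOn_lim :
    FunctionSpaces.Torus.IsWeakNSSolutionWithDataOn T 1 (D.U 0 0) D.lim := by
  refine ⟨D.aestronglyMeasurable_stLift_lim, D.lintegral_lintegral_enorm_lim_sq_lt_top,
    D.ae_isWeaklyDivFree_lim, fun ψ hψ hψdiv => ?_⟩
  have hT := D.T_pos
  have hU : UniqueDiffOn ℝ (Icc 0 T) := uniqueDiffOn_Icc hT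
  have hψI : FunctionSpaces.Torus.IsSmoothSpaceTimeOn (Icc 0 T) ψ := hψ.1.contDiffOn
  have hψ'I : FunctionSpaces.Torus.IsSmoothSpaceTimeOn (Icc 0 T) (FunctionSpaces.Torus.timeDeriv ψ) :=
    hψ.timeDeriv.1.contDiffOn
  have hDψ : ∀ j, FunctionSpaces.Torus.IsSmoothSpaceTimeOn (Icc 0 T)
      (fun t => FunctionSpaces.Torus.partialDeriv j (ψ t)) := fun j => hψI.partialDeriv hU j
  have hLψ : FunctionSpaces.Torus.IsSmoothSpaceTimeOn (Icc 0 T)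
      (fun t => FunctionSpaces.Torus.laplacian (ψ t)) := hψI.laplacian hU
  -- uniform bounds of `∂ₜψ`, `∂ⱼψ`, `Δψ` on `[0, T] × 𝕋^d`
  obtain ⟨K₁, hK₁⟩ := hψ'I.exists_norm_le_of_isCompact isCompact_Icc subset_rfl
  have hK₁0 : 0 ≤ K₁ := (norm_nonneg _).trans (hK₁ 0 ⟨le_rfl, hT.le⟩ 0)
  obtain ⟨K₂, hK₂0, hK₂⟩ : ∃ K₂, 0 ≤ K₂ ∧
      ∀ j, ∀ t ∈ Icc 0 T, ∀ x, ‖FunctionSpaces.Torus.partialDeriv j (ψ t) x‖ ≤ K₂ := by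
    choose K hK using fun j => (hDψ j).exists_norm_le_of_isCompact isCompact_Icc subset_rfl
    refine ⟨∑ j, |K j|, Finset.sum_nonneg fun j _ => abs_nonneg _, fun j t ht x => ?_⟩
    exact ((hK j t ht x).trans (le_abs_self _)).trans
      (Finset.single_le_sum (fun i _ => abs_nonneg (K i)) (Finset.mem_univ j))
  obtain ⟨K₃, hK₃⟩ := hLψ.exists_norm_le_of_isCompact isCompact_Icc subset_rfl
  have hK₃0 : 0 ≤ K₃ := (norm_nonneg _).trans (hK₃ 0 ⟨le_rfl, hT.le⟩ 0)
  -- the slice functionals of `uₖ` and of the limit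
  set F : ℕ → ℝ → ℝ := fun k t => ∫ x, (⟪D.U k t x, FunctionSpaces.Torus.timeDeriv ψ t x⟫_ℝ +
      ⟪D.U k t x, FunctionSpaces.Torus.convect (D.U k t) (ψ t) x⟫_ℝ +
      1 * ⟪D.U k t x, FunctionSpaces.Torus.laplacian (ψ t) x⟫_ℝ) with hF
  set f : ℝ → ℝ := fun t => ∫ x, (⟪D.lim t x, FunctionSpaces.Torus.timeDeriv ψ t x⟫_ℝ +
      ⟪D.lim t x, FunctionSpaces.Torus.convect (D.lim t) (ψ t) x⟫_ℝ +
      1 * ⟪D.lim t x, FunctionSpaces.Torus.laplacian (ψ t) x⟫_ℝ) with hf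
  -- (1) the weak identity with Reynolds defect for each `uₖ` (datum `uₖ(0) = u₀(0)`)
  have hWI : ∀ k, (∫ t in Ioo 0 T, F k t) + ∫ x, ⟪D.U 0 0 x, ψ 0 x⟫_ℝ =
      ∫ t in Ioo 0 T, ∫ x, ∑ j, ⟪D.R k t x j, FunctionSpaces.Torus.partialDeriv j (ψ t) x⟫_ℝ := by
    intro k
    have h := (D.nsr k).weak_identity subset_rfl hT hψ hψdiv
    rw [D.U_zero_eq k] at h
    exact h
  -- (2) the defects tend to `0` with `‖Rₖ‖_{L¹L¹}`
  have hdef : Tendsto (fun k => ∫ t in Ioo 0 T, ∫ x,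
      ∑ j, ⟪D.R k t x j, FunctionSpaces.Torus.partialDeriv j (ψ t) x⟫_ℝ) atTop (𝓝 0) := by
    have hb : ∀ k, ‖∫ t in Ioo 0 T, ∫ x, ∑ j, ⟪D.R k t x j, FunctionSpaces.Torus.partialDeriv j (ψ t) x⟫_ℝ‖ ≤
        Fintype.card d * K₂ * (eLqLpNorm 1 1 (D.R k) (Ioo 0 T)).toReal := fun k =>
      norm_integral_reynoldsDefect_le_eLqLpNorm (D.nsr k).smooth_stress
        fun t ht x j => hK₂ j t (Ioo_subset_Icc_self ht) x
    have h0 : Tendsto (fun k => Fintype.card d * K₂ * (eLqLpNorm 1 1 (D.R k) (Ioo 0 T)).toReal)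
        atTop (𝓝 0) := by
      have h := (ENNReal.tendsto_toReal ENNReal.zero_ne_top).comp D.tendsto_eLqLpNorm_stress
      rw [ENNReal.toReal_zero] at h
      simpa using h.const_mul (Fintype.card d * K₂ : ℝ)
    exact squeeze_zero_norm hb h0
  -- (3) dominated convergence in time for the bulk terms
  have hres : ∀ᵐ t ∂(volume.restrict (Ioo 0 T)), t ∉ D.residual :=
    ae_restrict_of_ae (measure_eq_zero_iff_ae_notMem.1 D.volume_residual)
  have hlim : Tendsto (fun k => ∫ t in Ioo 0 T, F k t) atTop (𝓝 (∫ t in Ioo 0 T, f t)) := by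
    set c₁ : ℝ := K₁ + K₃ with hc₁
    set c₂ : ℝ := K₁ + K₃ + Fintype.card d * K₂ with hc₂
    refine tendsto_integral_of_dominated_convergence (fun t => c₁ + c₂ * (D.H t ^ (2 : ℝ)).toReal)
      (fun k => ?_) ?_ (fun k => ?_) ?_
    · -- measurability: `F k` is continuous on `[0, T]`
      have hv := (D.nsr k).smooth_velocity
      have hsm : FunctionSpaces.Torus.IsSmoothSpaceTimeOn (Icc 0 T) (fun t x =>
          ⟪D.U k t x, FunctionSpaces.Torus.timeDeriv ψ t x⟫_ℝ +
          ⟪D.U k t x, FunctionSpaces.Torus.convect (D.U k t) (ψ t) x⟫_ℝ +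
          1 * ⟪D.U k t x, FunctionSpaces.Torus.laplacian (ψ t) x⟫_ℝ) :=
        ((hv.inner hψ'I).add (hv.inner (hv.convect hψI hU))).add ((hv.inner hLψ).const_smul 1)
      exact ((hsm.continuousOn_integral (convex_Icc 0 T)).mono Ioo_subset_Icc_self).aestronglyMeasurable
        measurableSet_Ioo
    · -- integrability of the majorant `c₁ + c₂ H²`
      refine Integrable.add ?_ ((integrable_toReal_of_lintegral_ne_top
        (D.aemeasurable_H.pow_const _) D.lintegral_H_sq_lt_top.ne).const_mul c₂)
      exact integrableOn_const (by rw [Real.volume_Ioo]; exact ENNReal.ofReal_ne_top)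
    · -- domination `|F k t| ≤ c₁ + c₂ ‖uₖ(t)‖²_{L²} ≤ c₁ + c₂ H(t)²` at a.e. `t`
      filter_upwards [ae_restrict_mem measurableSet_Ioo, D.ae_H_lt_top] with t ht hHt
      have htI : t ∈ Icc 0 T := Ioo_subset_Icc_self ht
      have ha : FunctionSpaces.Torus.IsSmooth (D.U k t) := (D.nsr k).smooth_velocity.isSmooth_slice htI
      rw [Real.norm_eq_abs]
      refine (abs_integral_weakIntegrand_le ha (hψ.isSmooth_slice t) hK₁0 hK₃0 (hK₁ t htI)
        (fun x i => hK₂ i t htI x) (hK₃ t htI)).trans ?_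
      have hc₂0 : 0 ≤ c₂ := by positivity
      have hpow : eLpNorm (D.U k t) 2 volume ^ 2 ≤ D.H t ^ (2 : ℝ) := by
        rw [ENNReal.rpow_two]
        exact pow_le_pow_left' (D.eLpNorm_U_le_H htI k) 2
      have hne : D.H t ^ (2 : ℝ) ≠ ⊤ := ENNReal.rpow_ne_top_of_nonneg zero_le_two hHt.ne
      exact add_le_add le_rfl (mul_le_mul_of_nonneg_left (ENNReal.toReal_mono hne hpow) hc₂0)
    · -- a.e. convergence: off the residual set the slices stabilise
      filter_upwards [ae_restrict_mem measurableSet_Ioo, hres] with t ht hrt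
      refine (tendsto_const_nhds (x := f t)).congr' ?_
      filter_upwards [D.eventually_U_eq_lim (Ioo_subset_Icc_self ht) hrt] with k hk
      simp only [hF, hf, hk]
  -- (4) conclude by uniqueness of limits
  have h1 : Tendsto (fun k => (∫ t in Ioo 0 T, F k t) + ∫ x, ⟪D.U 0 0 x, ψ 0 x⟫_ℝ) atTop
      (𝓝 ((∫ t in Ioo 0 T, f t) + ∫ x, ⟪D.U 0 0 x, ψ 0 x⟫_ℝ)) := hlim.add_const _
  have h2 : Tendsto (fun k => (∫ t in Ioo 0 T, F k t) + ∫ x, ⟪D.U 0 0 x, ψ 0 x⟫_ℝ) atTop (𝓝 0) := by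
    simp_rw [hWI]
    exact hdef
  exact tendsto_nhds_unique h1 h2

end CheskidovLuoSequence

end Torus

end Literature.Analysis.FluidPDE
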